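import Summits.ResolutionOfSingularities.ResolutionOfSingularities.Theorems.FrobeniusLadderFInjectiveMacaulayficationTauFloorF5YChartIdent
import Summits.ResolutionOfSingularities.ResolutionOfSingularities.Theorems.FrobeniusLadderFInjectiveMacaulayficationReesChartFacts
import Literature.AlgebraicGeometry.Dimension.PointDimension
import Literature.AlgebraicGeometry.Resolution.CohenMacaulayUnmixed
import Literature.RingTheory.MvPolynomial.HomogeneousDimension
import Mathlib.Algebra.DualNumber
import HarnessLib

/-!
# (N1-Y) The Rees chart `D(ȳ²)` of `Bl_τ(P2d4F5)`: COHEN–MACAULAY at every prime, NOT FULL at the generic point of its exceptional divisor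
# (crux `FInjectiveMacaulayfication` stmt-ResolutionOfSingularities-15315, chain w45a; res-L1-w45a-plan-1 R18.32 «(N1) ROW #2 TWO-SIDED → stub-3»;
# seat res-L1-w45a-stub-3 g10)

[OURS · L1 W4.5a] Support file (`--supports stmt-ResolutionOfSingularities-15315 --as helper`); replaces the role of NO printed item; NOT a statement of
any manuscript; def-free; UNCONDITIONAL. AI-written (AI review is weaker than expert review).

`A₀ = k[X0..X4]/(f)`, `f = X4² + X0²X4 + X1⁵ + X2⁵ + X3⁵` (P2d4F5), `τ = Ideal.span {x̄0, x̄1², x̄2², x̄3², x̄4}`, the tower `T₃ ≃+* blowupAlgebra τ ȳ²`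
(`TauFloorF5YChartIdent.exists_chartEquiv`).
* §1 ★★ `cmCl_localization_blowupAlgebra` — the CM clause at EVERY prime of `A₀[τ/ȳ²]`: ONE application of the generic engine
  `FlatIntegralCM.cmCl_localization_of_isRegularRing` (`T₃` is Noetherian, free — hence flat — and finite — hence integral — over the regular ring
  `k[y,V₀,V₁,V₂]`), transported along the chart equivalence. No regular-sequence bookkeeping.
* §2 the prime `𝔭 = ker (T₃ → k[V₀,V₁,V₂])` (`y,u,t,V₄ ↦ 0`): `y ∈ 𝔭`; `T₃/𝔭 ≅ k[V₀,V₁,V₂]`; `dim T₃ = 4` (integral over `k[y,V₀,V₁,V₂]`); `ht 𝔭 = 1`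
  (`ht + coht ≤ dim`, and `𝔭 ∋ y²`, a non-zero-divisor, is not minimal).
* §3 ★★ `not_fullCl_atPrime_ker` — `¬ FullCl 2 ((T₃)_𝔭)`: `dim = 1`, `(y)` is a system of parameters (a one-dimensional local DOMAIN), `u² = y²·V₁ ∈ (y)^{[2]}` but
  `u ∉ (y)(T₃)_𝔭` — the map `T₃ → K[ε]`, `K = Frac k[V₀,V₁,V₂]`, `y, V₄ ↦ 0`, `u ↦ V₂²ε`, `t ↦ −V₁²ε` kills `(y)` and not `u` (elements off `𝔭` go to units).
* §4 ★★ `exists_prime_not_fullCl_blowupAlgebra` — tower-free export: a prime `Q ∋ ȳ²/1` of `blowupAlgebra τ ȳ²` with `¬ FullCl 2 ((A₀[τ/ȳ²])_Q)` — the input of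
  `TauFloorInputNotFull.exists_point_over_centre_not_fullCl` (res-L1-w45a-stub-1) for row #2.
[cite: Matsumura1987, Thm. 17.8, Thm. 23.3 (context), §5 (coheight)] [cite: Fedder1983, Prop. 1.7 (context)] [cite: GortzWedhorn2020, (13.19)]
-/

-- single-problem summit: the doubled namespace component is forced
set_option linter.dupNamespace false

noncomputable section

namespace Summit.ResolutionOfSingularities.ResolutionOfSingularities.Theorems.FInjectiveMacaulayfication.TauFloorF5YChartFacts

open MvPolynomial IsLocalization IsLocalRing Literature.AlgebraicGeometry.Resolution DualNumber
open Summit.ResolutionOfSingularities.ResolutionOfSingularities.Theorems.FInjectiveMacaulayfication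
open SliceableCentre TauFloorF5YChartAlgebra TauFloorF5YChartIdent

variable (k : Type) [Field k]

/-! ## §1 CM at every prime of the chart ring -/

set_option maxHeartbeats 800000 in
-- instance assembly along the tower + one transport
/-- ★★ **CM at every prime of `A₀[τ/ȳ²]`** — by the generic flat–integral engine (p629082) applied to the free finite tower `T₃ / k[y,V₀,V₁,V₂]`, transported
along `T₃ ≃+* blowupAlgebra τ ȳ²`. [cite: Matsumura1987, Thm. 17.8, Thm. 23.3 (context)] -/
theorem cmCl_localization_blowupAlgebra (f : MvPolynomial (Fin 5) k) (hf : f = X 4 ^ 2 + X 0 ^ 2 * X 4 + X 1 ^ 5 + X 2 ^ 5 + X 3 ^ 5)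
    (Q : Ideal (blowupAlgebra (Ideal.span {Ideal.Quotient.mk (Ideal.span {f}) (X 0), Ideal.Quotient.mk (Ideal.span {f}) (X 1) ^ 2,
      Ideal.Quotient.mk (Ideal.span {f}) (X 2) ^ 2, Ideal.Quotient.mk (Ideal.span {f}) (X 3) ^ 2, Ideal.Quotient.mk (Ideal.span {f}) (X 4)} :
        Ideal (MvPolynomial (Fin 5) k ⧸ Ideal.span {f})) (Ideal.Quotient.mk (Ideal.span {f}) (X 1) ^ 2))) [Q.IsPrime] :
    CMCl (Localization.AtPrime Q) := by
  -- the tower, instantiated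
  let h₁ : Polynomial (MvPolynomial (Fin 4) k) := Polynomial.X ^ 2 - Polynomial.C (X 0 ^ 2 * X 2)
  let h₂ : Polynomial (AdjoinRoot h₁) := Polynomial.X ^ 2 - Polynomial.C (algebraMap (MvPolynomial (Fin 4) k) (AdjoinRoot h₁) (X 0 ^ 2 * X 3))
  let h₃ : Polynomial (AdjoinRoot h₂) := Polynomial.X ^ 2 + (Polynomial.C (algebraMap (MvPolynomial (Fin 4) k) (AdjoinRoot h₂) (X 0 ^ 2 * X 1 ^ 2)) * Polynomial.X +
      Polynomial.C (algebraMap (MvPolynomial (Fin 4) k) (AdjoinRoot h₂) (X 0) +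
        algebraMap (MvPolynomial (Fin 4) k) (AdjoinRoot h₂) (X 2 ^ 2) * AdjoinRoot.of h₂ (AdjoinRoot.root h₁) +
        algebraMap (MvPolynomial (Fin 4) k) (AdjoinRoot h₂) (X 3 ^ 2) * AdjoinRoot.root h₂))
  obtain ⟨hfree, hfin⟩ := free_finite_tower k h₁ rfl h₂ rfl h₃ rfl
  haveI : Algebra.IsIntegral (MvPolynomial (Fin 4) k) (AdjoinRoot h₃) := Algebra.IsIntegral.of_finite _ _
  obtain ⟨e, -⟩ := exists_chartEquiv k f hf h₁ rfl h₂ rfl h₃ rfl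
  exact ReesChartFacts.transport_cmCl e (fun P _ => FlatIntegralCM.cmCl_localization_of_isRegularRing (A := MvPolynomial (Fin 4) k) P) Q


/-! ## §2 The prime `𝔭 = ker (T₃ → k[V₀,V₁,V₂])` -/

set_option maxHeartbeats 800000 in
-- three `AdjoinRoot.lift`s
/-- **The map `π : T₃ → k[V₀,V₁,V₂]`**, `y, u, t, V₄ ↦ 0`, `V₀,V₁,V₂ ↦ V₀,V₁,V₂` (indices shift by one: `X (i+1) ↦ X i`), constants to constants; it is surjective.
[plumbing] -/
theorem exists_kerMap (h₁ : Polynomial (MvPolynomial (Fin 4) k)) (hh₁ : h₁ = Polynomial.X ^ 2 - Polynomial.C (X 0 ^ 2 * X 2))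
    (h₂ : Polynomial (AdjoinRoot h₁)) (hh₂ : h₂ = Polynomial.X ^ 2 - Polynomial.C (algebraMap (MvPolynomial (Fin 4) k) (AdjoinRoot h₁) (X 0 ^ 2 * X 3)))
    (h₃ : Polynomial (AdjoinRoot h₂))
    (hh₃ : h₃ = Polynomial.X ^ 2 + (Polynomial.C (algebraMap (MvPolynomial (Fin 4) k) (AdjoinRoot h₂) (X 0 ^ 2 * X 1 ^ 2)) * Polynomial.X +
      Polynomial.C (algebraMap (MvPolynomial (Fin 4) k) (AdjoinRoot h₂) (X 0) +
        algebraMap (MvPolynomial (Fin 4) k) (AdjoinRoot h₂) (X 2 ^ 2) * AdjoinRoot.of h₂ (AdjoinRoot.root h₁) +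
        algebraMap (MvPolynomial (Fin 4) k) (AdjoinRoot h₂) (X 3 ^ 2) * AdjoinRoot.root h₂))) :
    ∃ π : AdjoinRoot h₃ →+* MvPolynomial (Fin 3) k,
      (∀ a : k, π (algebraMap (MvPolynomial (Fin 4) k) (AdjoinRoot h₃) (C a)) = C a) ∧
      (∀ i : Fin 4, π (algebraMap (MvPolynomial (Fin 4) k) (AdjoinRoot h₃) (X i)) = ![0, X 0, X 1, X 2] i) ∧
      π (algebraMap (AdjoinRoot h₁) (AdjoinRoot h₃) (AdjoinRoot.root h₁)) = 0 ∧ π (AdjoinRoot.of h₃ (AdjoinRoot.root h₂)) = 0 ∧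
      π (AdjoinRoot.root h₃) = 0 ∧ Function.Surjective π := by
  let π₀ : MvPolynomial (Fin 4) k →+* MvPolynomial (Fin 3) k := eval₂Hom MvPolynomial.C ![0, X 0, X 1, X 2]
  have hπ₀0 : π₀ (X 0) = 0 := (eval₂Hom_X' _ _ 0).trans rfl
  have e1 : h₁.eval₂ π₀ 0 = 0 := by
    subst hh₁
    rw [Polynomial.eval₂_sub, Polynomial.eval₂_X_pow, Polynomial.eval₂_C, map_mul, map_pow, hπ₀0]; ring
  let π₁ : AdjoinRoot h₁ →+* MvPolynomial (Fin 3) k := AdjoinRoot.lift π₀ 0 e1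
  have hπ₁of : ∀ b, π₁ (AdjoinRoot.of h₁ b) = π₀ b := fun b => AdjoinRoot.lift_of e1
  have e2 : h₂.eval₂ π₁ 0 = 0 := by
    subst hh₂
    rw [Polynomial.eval₂_sub, Polynomial.eval₂_X_pow, Polynomial.eval₂_C, AdjoinRoot.algebraMap_eq, hπ₁of, map_mul, map_pow, hπ₀0]; ring
  have hπ₁root : π₁ (AdjoinRoot.root h₁) = 0 := AdjoinRoot.lift_root e1
  let π₂ : AdjoinRoot h₂ →+* MvPolynomial (Fin 3) k := AdjoinRoot.lift π₁ 0 e2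
  have hπ₂of : ∀ b, π₂ (AdjoinRoot.of h₂ b) = π₁ b := fun b => AdjoinRoot.lift_of e2
  have hπ₂root : π₂ (AdjoinRoot.root h₂) = 0 := AdjoinRoot.lift_root e2
  have hπ₂B : ∀ b, π₂ (algebraMap (MvPolynomial (Fin 4) k) (AdjoinRoot h₂) b) = π₀ b := fun b => by
    rw [IsScalarTower.algebraMap_apply (MvPolynomial (Fin 4) k) (AdjoinRoot h₁) (AdjoinRoot h₂), AdjoinRoot.algebraMap_eq, AdjoinRoot.algebraMap_eq, hπ₂of, hπ₁of]
  have e3 : h₃.eval₂ π₂ 0 = 0 := by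
    subst hh₃
    simp only [Polynomial.eval₂_add, Polynomial.eval₂_mul, Polynomial.eval₂_X_pow, Polynomial.eval₂_C, Polynomial.eval₂_X]
    simp only [map_add, map_mul, map_pow, hπ₂B, hπ₂of, hπ₁root, hπ₂root, hπ₀0]
    ring
  let π₃ : AdjoinRoot h₃ →+* MvPolynomial (Fin 3) k := AdjoinRoot.lift π₂ 0 e3
  have hπ₃of : ∀ b, π₃ (AdjoinRoot.of h₃ b) = π₂ b := fun b => AdjoinRoot.lift_of e3
  have hπ₃B : ∀ b, π₃ (algebraMap (MvPolynomial (Fin 4) k) (AdjoinRoot h₃) b) = π₀ b := fun b => by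
    rw [IsScalarTower.algebraMap_apply (MvPolynomial (Fin 4) k) (AdjoinRoot h₂) (AdjoinRoot h₃), AdjoinRoot.algebraMap_eq h₃, hπ₃of, hπ₂B]
  have hC : ∀ a : k, π₃ (algebraMap (MvPolynomial (Fin 4) k) (AdjoinRoot h₃) (C a)) = C a := fun a => by rw [hπ₃B]; exact eval₂Hom_C _ _ a
  have hX : ∀ i : Fin 4, π₃ (algebraMap (MvPolynomial (Fin 4) k) (AdjoinRoot h₃) (X i)) = ![0, X 0, X 1, X 2] i := fun i => by
    rw [hπ₃B]; exact eval₂Hom_X' _ _ i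
  refine ⟨π₃, hC, hX, ?_, ?_, AdjoinRoot.lift_root e3, ?_⟩
  · rw [IsScalarTower.algebraMap_apply (AdjoinRoot h₁) (AdjoinRoot h₂) (AdjoinRoot h₃), AdjoinRoot.algebraMap_eq h₃, AdjoinRoot.algebraMap_eq h₂,
      hπ₃of, hπ₂of, hπ₁root]
  · rw [hπ₃of, hπ₂root]
  · intro q
    induction q using MvPolynomial.induction_on with
    | C a => exact ⟨_, hC a⟩
    | add p q hp hq => obtain ⟨a, rfl⟩ := hp; obtain ⟨b, rfl⟩ := hq; exact ⟨a + b, map_add _ _ _⟩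
    | mul_X p i hp =>
      obtain ⟨a, rfl⟩ := hp
      refine ⟨a * algebraMap (MvPolynomial (Fin 4) k) (AdjoinRoot h₃) (X i.succ), ?_⟩
      rw [map_mul, hX]
      fin_cases i <;> rfl

set_option synthInstance.maxHeartbeats 200000 in
set_option maxHeartbeats 1600000 in
-- three `AdjoinRoot.lift`s into the dual numbers over a fraction field (instance-heavy)
/-- **The witness map `Ψ : T₃ → K[ε]`, `K = Frac k[V₀,V₁,V₂]`**: `y, V₄ ↦ 0`, `Vᵢ ↦ Vᵢ`, `u ↦ V₂²·ε`, `t ↦ −V₁²·ε` (`h₁ ↦ (V₂²ε)² = 0`, `h₂` likewise,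
`h₃ ↦ V₁²·V₂²ε − V₂²·V₁²ε = 0`). [plumbing] -/
theorem exists_dualMap (h₁ : Polynomial (MvPolynomial (Fin 4) k)) (hh₁ : h₁ = Polynomial.X ^ 2 - Polynomial.C (X 0 ^ 2 * X 2))
    (h₂ : Polynomial (AdjoinRoot h₁)) (hh₂ : h₂ = Polynomial.X ^ 2 - Polynomial.C (algebraMap (MvPolynomial (Fin 4) k) (AdjoinRoot h₁) (X 0 ^ 2 * X 3)))
    (h₃ : Polynomial (AdjoinRoot h₂))
    (hh₃ : h₃ = Polynomial.X ^ 2 + (Polynomial.C (algebraMap (MvPolynomial (Fin 4) k) (AdjoinRoot h₂) (X 0 ^ 2 * X 1 ^ 2)) * Polynomial.X +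
      Polynomial.C (algebraMap (MvPolynomial (Fin 4) k) (AdjoinRoot h₂) (X 0) +
        algebraMap (MvPolynomial (Fin 4) k) (AdjoinRoot h₂) (X 2 ^ 2) * AdjoinRoot.of h₂ (AdjoinRoot.root h₁) +
        algebraMap (MvPolynomial (Fin 4) k) (AdjoinRoot h₂) (X 3 ^ 2) * AdjoinRoot.root h₂))) :
    ∃ Ψ : AdjoinRoot h₃ →+* (FractionRing (MvPolynomial (Fin 3) k))[ε],
      (∀ a : k, Ψ (algebraMap (MvPolynomial (Fin 4) k) (AdjoinRoot h₃) (C a)) =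
        TrivSqZeroExt.inl (algebraMap (MvPolynomial (Fin 3) k) (FractionRing (MvPolynomial (Fin 3) k)) (C a))) ∧
      (∀ i : Fin 4, Ψ (algebraMap (MvPolynomial (Fin 4) k) (AdjoinRoot h₃) (X i)) =
        ![0, TrivSqZeroExt.inl (algebraMap (MvPolynomial (Fin 3) k) (FractionRing (MvPolynomial (Fin 3) k)) (X 0)),
          TrivSqZeroExt.inl (algebraMap (MvPolynomial (Fin 3) k) (FractionRing (MvPolynomial (Fin 3) k)) (X 1)),
          TrivSqZeroExt.inl (algebraMap (MvPolynomial (Fin 3) k) (FractionRing (MvPolynomial (Fin 3) k)) (X 2))] i) ∧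
      Ψ (algebraMap (AdjoinRoot h₁) (AdjoinRoot h₃) (AdjoinRoot.root h₁)) =
        TrivSqZeroExt.inl (algebraMap (MvPolynomial (Fin 3) k) (FractionRing (MvPolynomial (Fin 3) k)) (X 2) ^ 2) * ε ∧
      Ψ (AdjoinRoot.of h₃ (AdjoinRoot.root h₂)) =
        -(TrivSqZeroExt.inl (algebraMap (MvPolynomial (Fin 3) k) (FractionRing (MvPolynomial (Fin 3) k)) (X 1) ^ 2) * ε) ∧
      Ψ (AdjoinRoot.root h₃) = 0 := by
  let K := FractionRing (MvPolynomial (Fin 3) k)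
  let ι' : MvPolynomial (Fin 3) k →+* K := algebraMap _ _
  let c₀ : K[ε] := TrivSqZeroExt.inl (ι' (X 0))
  let c₁ : K[ε] := TrivSqZeroExt.inl (ι' (X 1))
  let c₂ : K[ε] := TrivSqZeroExt.inl (ι' (X 2))
  let Ψ₀ : MvPolynomial (Fin 4) k →+* K[ε] := eval₂Hom ((TrivSqZeroExt.inlHom K K).comp (ι'.comp MvPolynomial.C)) ![0, c₀, c₁, c₂]
  have hΨ₀0 : Ψ₀ (X 0) = 0 := (eval₂Hom_X' _ _ 0).trans rfl
  have hΨ₀2 : Ψ₀ (X 2) = c₁ := (eval₂Hom_X' _ _ 2).trans rfl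
  have hΨ₀3 : Ψ₀ (X 3) = c₂ := (eval₂Hom_X' _ _ 3).trans rfl
  have hε : (ε : K[ε]) ^ 2 = 0 := DualNumber.eps_pow_two
  have e1 : h₁.eval₂ Ψ₀ (TrivSqZeroExt.inl (ι' (X 2) ^ 2) * ε) = 0 := by
    subst hh₁
    rw [Polynomial.eval₂_sub, Polynomial.eval₂_X_pow, Polynomial.eval₂_C, map_mul, map_pow, hΨ₀0]
    generalize (TrivSqZeroExt.inl (ι' (X 2) ^ 2) : K[ε]) = a
    generalize (ε : K[ε]) = e at hε ⊢
    linear_combination a ^ 2 * hε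
  let Ψ₁ : AdjoinRoot h₁ →+* K[ε] := AdjoinRoot.lift Ψ₀ _ e1
  have hΨ₁of : ∀ b, Ψ₁ (AdjoinRoot.of h₁ b) = Ψ₀ b := fun b => AdjoinRoot.lift_of e1
  have e2 : h₂.eval₂ Ψ₁ (-(TrivSqZeroExt.inl (ι' (X 1) ^ 2) * ε)) = 0 := by
    subst hh₂
    rw [Polynomial.eval₂_sub, Polynomial.eval₂_X_pow, Polynomial.eval₂_C, AdjoinRoot.algebraMap_eq, hΨ₁of, map_mul, map_pow, hΨ₀0]
    generalize (TrivSqZeroExt.inl (ι' (X 1) ^ 2) : K[ε]) = a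
    generalize (ε : K[ε]) = e at hε ⊢
    linear_combination a ^ 2 * hε
  have hΨ₁root : Ψ₁ (AdjoinRoot.root h₁) = TrivSqZeroExt.inl (ι' (X 2) ^ 2) * ε := AdjoinRoot.lift_root e1
  let Ψ₂ : AdjoinRoot h₂ →+* K[ε] := AdjoinRoot.lift Ψ₁ _ e2
  have hΨ₂of : ∀ b, Ψ₂ (AdjoinRoot.of h₂ b) = Ψ₁ b := fun b => AdjoinRoot.lift_of e2
  have hΨ₂root : Ψ₂ (AdjoinRoot.root h₂) = -(TrivSqZeroExt.inl (ι' (X 1) ^ 2) * ε) := AdjoinRoot.lift_root e2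
  have hΨ₂B : ∀ b, Ψ₂ (algebraMap (MvPolynomial (Fin 4) k) (AdjoinRoot h₂) b) = Ψ₀ b := fun b => by
    rw [IsScalarTower.algebraMap_apply (MvPolynomial (Fin 4) k) (AdjoinRoot h₁) (AdjoinRoot h₂), AdjoinRoot.algebraMap_eq, AdjoinRoot.algebraMap_eq, hΨ₂of, hΨ₁of]
  have e3 : h₃.eval₂ Ψ₂ 0 = 0 := by
    subst hh₃
    simp only [Polynomial.eval₂_add, Polynomial.eval₂_mul, Polynomial.eval₂_X_pow, Polynomial.eval₂_C, Polynomial.eval₂_X]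
    simp only [map_add, map_mul, hΨ₂B, hΨ₂of, hΨ₁root, hΨ₂root, hΨ₀0]
    simp only [map_pow, hΨ₀2, hΨ₀3, hΨ₀0]
    have h1 : (TrivSqZeroExt.inl (ι' (X 2) ^ 2) : K[ε]) = c₂ ^ 2 := by
      change TrivSqZeroExt.inlHom K K (ι' (X 2) ^ 2) = (TrivSqZeroExt.inlHom K K (ι' (X 2))) ^ 2; rw [map_pow]
    have h2 : (TrivSqZeroExt.inl (ι' (X 1) ^ 2) : K[ε]) = c₁ ^ 2 := by
      change TrivSqZeroExt.inlHom K K (ι' (X 1) ^ 2) = (TrivSqZeroExt.inlHom K K (ι' (X 1))) ^ 2; rw [map_pow]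
    rw [h1, h2]
    generalize Ψ₀ (X 0 ^ 2 * X 1 ^ 2) = w
    generalize (ε : K[ε]) = e
    ring
  let Ψ₃ : AdjoinRoot h₃ →+* K[ε] := AdjoinRoot.lift Ψ₂ 0 e3
  have hΨ₃of : ∀ b, Ψ₃ (AdjoinRoot.of h₃ b) = Ψ₂ b := fun b => AdjoinRoot.lift_of e3
  have hΨ₃B : ∀ b, Ψ₃ (algebraMap (MvPolynomial (Fin 4) k) (AdjoinRoot h₃) b) = Ψ₀ b := fun b => by
    rw [IsScalarTower.algebraMap_apply (MvPolynomial (Fin 4) k) (AdjoinRoot h₂) (AdjoinRoot h₃), AdjoinRoot.algebraMap_eq h₃, hΨ₃of, hΨ₂B]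
  refine ⟨Ψ₃, fun a => ?_, fun i => ?_, ?_, ?_, AdjoinRoot.lift_root e3⟩
  · rw [hΨ₃B]; exact eval₂Hom_C _ _ a
  · rw [hΨ₃B]; exact eval₂Hom_X' _ _ i
  · rw [IsScalarTower.algebraMap_apply (AdjoinRoot h₁) (AdjoinRoot h₂) (AdjoinRoot h₃), AdjoinRoot.algebraMap_eq h₃, AdjoinRoot.algebraMap_eq h₂,
      hΨ₃of, hΨ₂of, hΨ₁root]
  · rw [hΨ₃of, hΨ₂root]


/-! ## §3 `¬ FullCl 2` at `𝔭 = ker π` -/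

set_option synthInstance.maxHeartbeats 200000 in
set_option maxHeartbeats 1600000 in
-- dimension count + one localization lift into `K[ε]`
/-- ★★ **The chart ring `T₃ ≅ A₀[τ/ȳ²]` is NOT FULL at `𝔭 = ker (T₃ → k[V₀,V₁,V₂])`**, the generic point of the exceptional divisor of `D(ȳ²)`: `dim (T₃)_𝔭 = 1`
(`ht 𝔭 + coht 𝔭 ≤ dim T₃ = 4`, `coht 𝔭 = dim k[V₀,V₁,V₂] = 3`, and `𝔭 ∋ y²`, a non-zero-divisor, is not minimal), `(y)` is a system of parameters (in a one-dimensional local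
domain every non-zero prime is maximal), `u² = y²·V₁ ∈ (y)^{[2]}` but `u ∉ (y)` (the witness map `Ψ` of `exists_dualMap` kills `(y)`, sends `u` to `V₂²·ε ≠ 0`, and sends
elements off `𝔭` to units). [cite: Fedder1983, Prop. 1.7 (context)] [cite: Matsumura1987, §5, Thm. 13.5 (context)] -/
theorem not_fullCl_atPrime_of_eq_ker (h₁ : Polynomial (MvPolynomial (Fin 4) k)) (hh₁ : h₁ = Polynomial.X ^ 2 - Polynomial.C (X 0 ^ 2 * X 2))
    (h₂ : Polynomial (AdjoinRoot h₁)) (hh₂ : h₂ = Polynomial.X ^ 2 - Polynomial.C (algebraMap (MvPolynomial (Fin 4) k) (AdjoinRoot h₁) (X 0 ^ 2 * X 3)))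
    (h₃ : Polynomial (AdjoinRoot h₂))
    (hh₃ : h₃ = Polynomial.X ^ 2 + (Polynomial.C (algebraMap (MvPolynomial (Fin 4) k) (AdjoinRoot h₂) (X 0 ^ 2 * X 1 ^ 2)) * Polynomial.X +
      Polynomial.C (algebraMap (MvPolynomial (Fin 4) k) (AdjoinRoot h₂) (X 0) +
        algebraMap (MvPolynomial (Fin 4) k) (AdjoinRoot h₂) (X 2 ^ 2) * AdjoinRoot.of h₂ (AdjoinRoot.root h₁) +
        algebraMap (MvPolynomial (Fin 4) k) (AdjoinRoot h₂) (X 3 ^ 2) * AdjoinRoot.root h₂)))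
    (π : AdjoinRoot h₃ →+* MvPolynomial (Fin 3) k)
    (hπC : ∀ a : k, π (algebraMap (MvPolynomial (Fin 4) k) (AdjoinRoot h₃) (C a)) = C a)
    (hπX : ∀ i : Fin 4, π (algebraMap (MvPolynomial (Fin 4) k) (AdjoinRoot h₃) (X i)) = ![0, X 0, X 1, X 2] i)
    (hπu : π (algebraMap (AdjoinRoot h₁) (AdjoinRoot h₃) (AdjoinRoot.root h₁)) = 0) (hπt : π (AdjoinRoot.of h₃ (AdjoinRoot.root h₂)) = 0)
    (hπV : π (AdjoinRoot.root h₃) = 0) (hsurj : Function.Surjective π)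
    (𝔭 : Ideal (AdjoinRoot h₃)) [𝔭.IsPrime] (h𝔭 : 𝔭 = RingHom.ker π) : ¬ FullCl 2 (Localization.AtPrime 𝔭) := by
  classical
  intro hfull
  subst h𝔭
  obtain ⟨hfree, hfin⟩ := free_finite_tower k h₁ hh₁ h₂ hh₂ h₃ hh₃
  haveI : Algebra.IsIntegral (MvPolynomial (Fin 4) k) (AdjoinRoot h₃) := Algebra.IsIntegral.of_finite _ _
  let aM : MvPolynomial (Fin 4) k →+* AdjoinRoot h₃ := algebraMap _ _
  let yT : AdjoinRoot h₃ := aM (X 0)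
  let uT : AdjoinRoot h₃ := algebraMap (AdjoinRoot h₁) (AdjoinRoot h₃) (AdjoinRoot.root h₁)
  let R := Localization.AtPrime (RingHom.ker π)
  let alg : AdjoinRoot h₃ →+* R := algebraMap _ _
  haveI : IsNoetherianRing R := IsLocalization.isNoetherianRing (RingHom.ker π).primeCompl _ inferInstance
  -- (0) `T₃` is nontrivial, `y` and `y²` are non-zero-divisors, `y ∈ 𝔭`
  have hne : RingHom.ker π ≠ ⊤ := Ideal.IsPrime.ne_top'
  haveI : Nontrivial (AdjoinRoot h₃) := ⟨⟨1, 0, fun h => hne ((Ideal.eq_top_iff_one _).mpr (h ▸ (RingHom.ker π).zero_mem))⟩⟩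
  have hy𝔭 : yT ∈ RingHom.ker π := by rw [RingHom.mem_ker]; exact (hπX 0).trans rfl
  have hy1 : yT ∈ nonZeroDivisors (AdjoinRoot h₃) := FlatIntegralCM.mem_nonZeroDivisors_algebraMap_of_flat_of_ne_zero (X_ne_zero (0 : Fin 4))
  have hy2 : yT ^ 2 ∈ nonZeroDivisors (AdjoinRoot h₃) := pow_mem hy1 2
  -- (1) `dim T₃ = 4`, `coht 𝔭 = 3`, hence `ht 𝔭 ≤ 1`; and `ht 𝔭 ≠ 0`
  have hinjB : Function.Injective (algebraMap (MvPolynomial (Fin 4) k) (AdjoinRoot h₃)) := by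
    haveI := Module.Free.instFaithfulSMulOfNontrivial (MvPolynomial (Fin 4) k) (AdjoinRoot h₃)
    exact FaithfulSMul.algebraMap_injective (MvPolynomial (Fin 4) k) (AdjoinRoot h₃)
  have hdimT : ringKrullDim (AdjoinRoot h₃) = (4 : ℕ) := by
    rw [← Literature.RingTheory.KrullDimension.ringKrullDim_eq_of_isIntegral hinjB]
    exact Literature.RingTheory.MvPolynomial.ringKrullDim_mvPolynomial_fin 4
  have hquot : ringKrullDim (AdjoinRoot h₃ ⧸ RingHom.ker π) = (3 : ℕ) := by
    rw [ringKrullDim_eq_of_ringEquiv (RingHom.quotientKerEquivOfSurjective hsurj)]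
    exact Literature.RingTheory.MvPolynomial.ringKrullDim_mvPolynomial_fin 3
  let P : PrimeSpectrum (AdjoinRoot h₃) := ⟨RingHom.ker π, inferInstance⟩
  have hco : ((Order.coheight P : ℕ∞) : WithBot ℕ∞) = ((3 : ℕ) : ℕ∞) := (Literature.AlgebraicGeometry.Dimension.PrimeSpectrum.coe_coheight_eq_ringKrullDim_quotient P).trans hquot
  have hco' : (Order.coheight P : ℕ∞) = 3 := by exact_mod_cast hco
  have hsum : ((Order.height P + Order.coheight P : ℕ∞) : WithBot ℕ∞) ≤ ((4 : ℕ) : ℕ∞) := (height_add_coheight_le_krullDim P).trans_eq hdimT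
  have hsum' : Order.height P + 3 ≤ (4 : ℕ∞) := by rw [← hco']; exact_mod_cast hsum
  have hfinite : Order.height P ≠ ⊤ := by intro htop; rw [htop, top_add] at hsum'; exact absurd hsum' (by simp)
  obtain ⟨n, hn⟩ := ENat.ne_top_iff_exists.mp hfinite
  have hn1 : n ≤ 1 := by
    rw [← hn] at hsum'
    have : (n : ℕ∞) + 3 = ((n + 3 : ℕ) : ℕ∞) := by push_cast; rfl
    rw [this, show (4 : ℕ∞) = ((4 : ℕ) : ℕ∞) from rfl, ENat.coe_le_coe] at hsum'
    omega
  have hP : (RingHom.ker π).height = Order.height P := PrimeSpectrum.height_eq_orderHeight P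
  have hn0 : n ≠ 0 := fun h0 => by
    have hz : (RingHom.ker π).height = 0 := by rw [hP, ← hn, h0]; rfl
    exact notMem_nonZeroDivisors_of_mem_mem_minimalPrimes (Ideal.pow_mem_of_mem _ hy𝔭 2 two_pos) (Ideal.height_eq_zero_iff.mp hz) hy2
  have hht : (RingHom.ker π).height = 1 := by rw [hP, ← hn]; exact_mod_cast (show n = 1 by omega)
  have hdim : ringKrullDim R = (1 : ℕ) := by rw [IsLocalization.AtPrime.ringKrullDim_eq_height (RingHom.ker π) R, hht]; rfl
  -- (2) the system of parameters `s = (y)`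
  haveI : IsDomain R := hfull.1
  set s : Fin 1 → R := fun _ => alg yT with hs
  have hy_mem : alg yT ∈ Ideal.span (Set.range s) := Ideal.subset_span ⟨0, rfl⟩
  have hy0 : alg yT ≠ 0 := fun h => by
    obtain ⟨⟨m, hm⟩, hm0⟩ := (IsLocalization.map_eq_zero_iff (RingHom.ker π).primeCompl R yT).mp h
    exact hm ((mem_nonZeroDivisors_iff_right.mp hy1) m hm0 ▸ (RingHom.ker π).zero_mem)
  have hmaxR : maximalIdeal R = (RingHom.ker π).map alg := (Localization.AtPrime.map_eq_maximalIdeal (I := RingHom.ker π)).symm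
  have hyR : alg yT ∈ maximalIdeal R := by rw [hmaxR]; exact Ideal.mem_map_of_mem _ hy𝔭
  have hprime_max : ∀ Q : Ideal R, Q.IsPrime → alg yT ∈ Q → Q = maximalIdeal R := by
    intro Q hQ hyQ
    have hQne : Q ≠ ⊥ := fun h => hy0 (by rw [h, Ideal.mem_bot] at hyQ; exact hyQ)
    have hQ0 : Q.height ≠ 0 := fun h => hQne (Ideal.height_eq_zero_iff_eq_bot.mp h)
    have hQle : (Q.height : WithBot ℕ∞) ≤ ringKrullDim R := Ideal.height_le_ringKrullDim_of_ne_top hQ.ne_top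
    rw [hdim] at hQle
    have hQ1 : Q.height = 1 := by
      have h' : Q.height ≤ 1 := by exact_mod_cast hQle
      exact (le_iff_lt_or_eq.mp h').elim (fun h'' => absurd (Order.lt_one_iff.mp h'') hQ0) id
    have hQmax : Q.IsMaximal := Ideal.isMaximal_of_height_eq_ringKrullDim (by rw [hQ1, hdim]; rfl)
    exact IsLocalRing.eq_maximalIdeal hQmax
  have hrad_eq : (Ideal.span (Set.range s)).radical = maximalIdeal R := by
    apply le_antisymm
    · have hle : Ideal.span (Set.range s) ≤ maximalIdeal R := by rw [Ideal.span_le]; rintro _ ⟨j, rfl⟩; exact hyR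
      exact (Ideal.radical_mono hle).trans_eq (IsLocalRing.maximalIdeal.isMaximal R).isPrime.radical
    · rw [Ideal.radical_eq_sInf]
      refine le_sInf fun J hJ => le_of_eq (hprime_max J hJ.2 (hJ.1 hy_mem)).symm
  have hrad : (Ideal.span (Set.range s)).radical.IsMaximal := by rw [hrad_eq]; exact IsLocalRing.maximalIdeal.isMaximal R
  -- (3) clause 3 of `FullCl 2` at `y₀ = u`, `e = 1`: `u² = y²·V₁ ∈ (y)^{[2]}`
  have R1 : uT ^ 2 = yT ^ 2 * aM (X 2) := by
    have h := congrArg (algebraMap (AdjoinRoot h₁) (AdjoinRoot h₃)) (root₁_sq k h₁ hh₁)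
    rw [map_pow, ← AdjoinRoot.algebraMap_eq, ← IsScalarTower.algebraMap_apply, map_mul, map_pow] at h
    exact h
  obtain ⟨-, hclause⟩ := hfull
  have hmem : alg uT ^ 2 ^ 1 ∈ Ideal.span ((fun z : R => z ^ 2 ^ 1) '' (Ideal.span (Set.range s) : Set R)) := by
    rw [pow_one, ← map_pow, R1, map_mul, mul_comm]
    exact Ideal.mul_mem_left _ _ (Ideal.subset_span ⟨alg yT, hy_mem, by simp only [map_pow]⟩)
  have hF3 := (hclause 1 hdim s hrad).2 (alg uT) ⟨1, hmem⟩
  -- (4) the witness map kills `(y)` but not `u`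
  let K := FractionRing (MvPolynomial (Fin 3) k)
  let ι' : MvPolynomial (Fin 3) k →+* K := algebraMap _ _
  obtain ⟨Ψ, hΨC, hΨX, hΨu, hΨt, hΨV⟩ := exists_dualMap k h₁ hh₁ h₂ hh₂ h₃ hh₃
  have hfstcomp : (TrivSqZeroExt.fstHom K K K).toRingHom.comp Ψ = ι'.comp π := by
    refine tower_ringHom_ext k h₁ h₂ h₃ (fun a => ?_) (fun i => ?_) ?_ ?_ ?_
    · change TrivSqZeroExt.fst (Ψ (algebraMap (MvPolynomial (Fin 4) k) (AdjoinRoot h₃) (C a))) = ι' (π (algebraMap (MvPolynomial (Fin 4) k) (AdjoinRoot h₃) (C a)))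
      rw [hΨC, hπC, TrivSqZeroExt.fst_inl]
    · change TrivSqZeroExt.fst (Ψ (algebraMap (MvPolynomial (Fin 4) k) (AdjoinRoot h₃) (X i))) = ι' (π (algebraMap (MvPolynomial (Fin 4) k) (AdjoinRoot h₃) (X i)))
      rw [hΨX, hπX]
      fin_cases i
      · simp
      all_goals rfl
    · change TrivSqZeroExt.fst (Ψ uT) = ι' (π uT)
      rw [hΨu, hπu, map_zero, TrivSqZeroExt.fst_mul, DualNumber.fst_eps, mul_zero]
    · change TrivSqZeroExt.fst (Ψ (AdjoinRoot.of h₃ (AdjoinRoot.root h₂))) = ι' (π (AdjoinRoot.of h₃ (AdjoinRoot.root h₂)))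
      rw [hΨt, hπt, map_zero, TrivSqZeroExt.fst_neg, TrivSqZeroExt.fst_mul, DualNumber.fst_eps, mul_zero, neg_zero]
    · change TrivSqZeroExt.fst (Ψ (AdjoinRoot.root h₃)) = ι' (π (AdjoinRoot.root h₃))
      rw [hΨV, hπV, map_zero, TrivSqZeroExt.fst_zero]
  have hfst : ∀ x, TrivSqZeroExt.fst (Ψ x) = ι' (π x) := fun x => RingHom.congr_fun hfstcomp x
  have hunit : ∀ z : (RingHom.ker π).primeCompl, IsUnit (Ψ z) := by
    rintro ⟨z, hz⟩
    rw [TrivSqZeroExt.isUnit_iff_isUnit_fst, hfst, isUnit_iff_ne_zero]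
    intro h0
    exact hz (RingHom.mem_ker.mpr (IsFractionRing.injective (MvPolynomial (Fin 3) k) K (by rw [map_zero]; exact h0)))
  let ΨR : R →+* K[ε] := IsLocalization.lift (M := (RingHom.ker π).primeCompl) (g := Ψ) hunit
  have hΨR : ∀ x, ΨR (alg x) = Ψ x := fun x => IsLocalization.lift_eq (M := (RingHom.ker π).primeCompl) hunit x
  have hkill : ∀ w ∈ Ideal.span (Set.range s), ΨR w = 0 := by
    intro w hw
    have hle : Ideal.span (Set.range s) ≤ RingHom.ker ΨR := by
      rw [Ideal.span_le]
      rintro _ ⟨j, rfl⟩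
      rw [SetLike.mem_coe, RingHom.mem_ker, hs]
      change ΨR (alg yT) = 0
      rw [hΨR]; exact (hΨX 0).trans rfl
    exact hle hw
  have h0 := hkill _ hF3
  rw [hΨR, hΨu] at h0
  have h1 := congrArg TrivSqZeroExt.snd h0
  rw [DualNumber.snd_mul, TrivSqZeroExt.fst_inl, DualNumber.snd_eps, TrivSqZeroExt.snd_inl, DualNumber.fst_eps, TrivSqZeroExt.snd_zero, mul_one,
    mul_zero, add_zero] at h1
  have h2 : ι' (X 2) = 0 := (pow_eq_zero_iff two_ne_zero).mp h1
  exact X_ne_zero (2 : Fin 3) (IsFractionRing.injective (MvPolynomial (Fin 3) k) K (h2.trans (map_zero ι').symm))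

/-! ## §4 Tower-free export -/

set_option synthInstance.maxHeartbeats 200000 in
set_option maxHeartbeats 1600000 in
-- transport along the chart equivalence
/-- ★★ **A prime `Q ∋ ȳ²/1` of `A₀[τ/ȳ²] = blowupAlgebra τ ȳ²` at which the chart ring of `Bl_τ(P2d4F5)` is NOT FULL** (the image of `ker (T₃ → k[V₀,V₁,V₂])`
under `T₃ ≃+* blowupAlgebra τ ȳ²`): the input of `TauFloorInputNotFull.exists_point_over_centre_not_fullCl` for row #2's «NOT F(4)-iso». Any field `k`.
[OURS · certificate; cite: Fedder1983, Prop. 1.7 (context)] -/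
theorem exists_prime_not_fullCl_blowupAlgebra (f : MvPolynomial (Fin 5) k) (hf : f = X 4 ^ 2 + X 0 ^ 2 * X 4 + X 1 ^ 5 + X 2 ^ 5 + X 3 ^ 5) :
    ∃ (Q : Ideal (blowupAlgebra (Ideal.span {Ideal.Quotient.mk (Ideal.span {f}) (X 0), Ideal.Quotient.mk (Ideal.span {f}) (X 1) ^ 2,
      Ideal.Quotient.mk (Ideal.span {f}) (X 2) ^ 2, Ideal.Quotient.mk (Ideal.span {f}) (X 3) ^ 2, Ideal.Quotient.mk (Ideal.span {f}) (X 4)} :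
        Ideal (MvPolynomial (Fin 5) k ⧸ Ideal.span {f})) (Ideal.Quotient.mk (Ideal.span {f}) (X 1) ^ 2))) (_ : Q.IsPrime),
      algebraMap (MvPolynomial (Fin 5) k ⧸ Ideal.span {f}) _ (Ideal.Quotient.mk (Ideal.span {f}) (X 1) ^ 2) ∈ Q ∧
      ¬ FullCl 2 (Localization.AtPrime Q) := by
  classical
  let h₁ : Polynomial (MvPolynomial (Fin 4) k) := Polynomial.X ^ 2 - Polynomial.C (X 0 ^ 2 * X 2)
  let h₂ : Polynomial (AdjoinRoot h₁) := Polynomial.X ^ 2 - Polynomial.C (algebraMap (MvPolynomial (Fin 4) k) (AdjoinRoot h₁) (X 0 ^ 2 * X 3))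
  let h₃ : Polynomial (AdjoinRoot h₂) := Polynomial.X ^ 2 + (Polynomial.C (algebraMap (MvPolynomial (Fin 4) k) (AdjoinRoot h₂) (X 0 ^ 2 * X 1 ^ 2)) * Polynomial.X +
      Polynomial.C (algebraMap (MvPolynomial (Fin 4) k) (AdjoinRoot h₂) (X 0) +
        algebraMap (MvPolynomial (Fin 4) k) (AdjoinRoot h₂) (X 2 ^ 2) * AdjoinRoot.of h₂ (AdjoinRoot.root h₁) +
        algebraMap (MvPolynomial (Fin 4) k) (AdjoinRoot h₂) (X 3 ^ 2) * AdjoinRoot.root h₂))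
  obtain ⟨π, hπC, hπX, hπu, hπt, hπV, hsurj⟩ := exists_kerMap k h₁ rfl h₂ rfl h₃ rfl
  obtain ⟨e, -, heX, -, -, -⟩ := exists_chartEquiv k f hf h₁ rfl h₂ rfl h₃ rfl
  haveI : (RingHom.ker π).IsPrime := RingHom.ker_isPrime π
  let Q := (RingHom.ker π).map e.toRingHom
  haveI hQ : Q.IsPrime := Ideal.map_isPrime_of_equiv e
  have hcomap : Q.comap e.toRingHom = RingHom.ker π := Ideal.comap_map_of_bijective e.toRingHom e.bijective
  haveI : (Q.comap e.toRingHom).IsPrime := Ideal.IsPrime.comap _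
  refine ⟨Q, hQ, ?_, fun hfull => ?_⟩
  · -- `ȳ²/1 = e (y)²`, and `y ∈ ker π`
    have hy : algebraMap (MvPolynomial (Fin 4) k) (AdjoinRoot h₃) (X 0) ∈ RingHom.ker π := by rw [RingHom.mem_ker]; exact (hπX 0).trans rfl
    have hval : e (algebraMap (MvPolynomial (Fin 4) k) (AdjoinRoot h₃) (X 0) ^ 2) =
        algebraMap (MvPolynomial (Fin 5) k ⧸ Ideal.span {f}) _ (Ideal.Quotient.mk (Ideal.span {f}) (X 1) ^ 2) := by
      apply Subtype.ext
      rw [map_pow, Subalgebra.coe_pow, heX 0, Subalgebra.coe_algebraMap, map_pow]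
      rfl
    rw [← hval]
    exact Ideal.mem_map_of_mem _ (Ideal.pow_mem_of_mem _ hy 2 two_pos)
  · obtain ⟨eQ⟩ := E8Char5FiModel.nonempty_ringEquiv_localization_comap e Q
    exact not_fullCl_atPrime_of_eq_ker k h₁ rfl h₂ rfl h₃ rfl π hπC hπX hπu hπt hπV hsurj (Q.comap e.toRingHom) hcomap
      (WFixAtNonClosedDimTwo.fullCl_of_ringEquiv 2 eQ.symm hfull)

end Summit.ResolutionOfSingularities.ResolutionOfSingularities.Theorems.FInjectiveMacaulayfication.TauFloorF5YChartFacts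

end
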